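import Summits.BirchSwinnertonDyer.BirchSwinnertonDyer.Theorems.PrintCf2RubinValueTwoEllipticUnitsGlobalUnits
import Summits.BirchSwinnertonDyer.BirchSwinnertonDyer.Theorems.PrintCf2RubinValueTwoEllipticUnitsLocalMeasurePrincipal
import Literature.NumberTheory.EllipticCurves.ProfiniteGroupDistributionInduceFromSubgroupDivision
import Literature.NumberTheory.EllipticCurves.ProfiniteGroupDistributionDivisionDataCongr
import Literature.NumberTheory.NumberFields.RayClassFieldAdicTowerAbsolute
import HarnessLib

/-!
# de Shalit II.4.12 ON `𝒢 = Gal(K̄/K)` (not only on `G = Gal(K̄/K(𝔪))`) for the ELLIPTIC UNITS: the integral measure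
# `μ(𝔪)` on `Γ_K` along `K(𝔪v^{n+1})` with `δ_{σ_𝔠, N𝔠} μ = i(e(𝔠))` for EVERY `𝔠` prime to `𝔪v`, `σ_𝔠 ∈ Γ_K` ANY Artin lift
# (brick B2: the semi-local / `Gal(K(𝔪)/K)`-coset induction, assembled — part 2 of 2)

Cell `bsd-print-cf2`, width seat `bsd-line-cf2-p1-w8` g9 (piece B2 of the measure side of de Shalit II.4 at `p = 2`, cf2c-w4
g10's successor list (2)); `--supports` the banked S3a item stmt-BirchSwinnertonDyer-24721 (helper, Theses-free).  THEOREMS ONLY;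
CONDITIONAL on the published named facts
`DeShalit1987.prop24_ii_galoisAction`, `prop24_iii_unit`, `prop25_i_normRelation` (hypotheses, never asserted).

PRINT (de Shalit II.4.1, p. 56: "`𝒢 = Gal(F_∞/K)`, `G = Gal(F_∞/F)`"; II.4.6, p. 59: "a unique `𝒢`-homomorphism
`i : 𝒰 → Λ(𝒢, R̂)`"; II.4.12, p. 66–69: "a unique `p`-adic integral measure `μ(𝔣)` on `𝒢(𝔣) = Gal(K(𝔣𝔭^∞)/K)` …
`μ_𝔞 = (σ_𝔞 − N𝔞) μ(𝔣)`" for ALL `𝔞` prime to `𝔣𝔭`; I.3.4, p. 18: the coset-by-coset extension of `μ_β` from `G` to `𝒢`).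
The tree's one-`𝔓` assembly `EllipticUnitsLocal.exists_groupDistribution_twisting_eq_induce_ellipticUnitsLocal` (cf2c-w4 g10,
p747710) produced `μ_𝔓(𝔪)` on the SUBGROUP `H = Gal(K̄/K(𝔪))` (the domain of the `v`-adic Artin character) with the twisting
relation only for the `𝔠` whose Artin lifts FIX `K(𝔪)`.  THIS file induces it to `Γ_K` (`GroupDistribution.induceFrom`,
`ProfiniteGroupDistributionInduceFromSubgroup.lean`) with the GLOBAL elliptic units as the `Γ_K`-monoid
(`GlobalNormCoherentUnits`, `RayClassTowerGlobalUnits.lean`; the `Γ_K`-action permutes the primes above `v` — the semi-local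
structure of II.4.1 (2)):

* (part 1, `…EllipticUnitsGlobalUnits.lean`: `ellipticUnitsGlobal`, `hrel_ellipticUnitsGlobal`, `localMeasureFamily`,
  `globalMeasureFamily_μ_smul/_μ_mul` — the `Γ_K`-monoid of global elliptic units and the `H`-equivariant additive family
  `b ↦ i_𝔓(b_𝔓)`);
* §3 ★★★ `exists_groupDistribution_twisting_eq_induceFrom_ellipticUnitsGlobal` — **de Shalit II.4.12 ON `Γ_K`**: a bounded
  `μ` on `Γ_K` along `absRayAdicTower h𝔪 v` (`U_n = Gal(K̄/K(𝔪v^{n+1}))`), `‖μ‖ = 1`, with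
  `δ_{σ_𝔠, N𝔠} μ = induceFrom (localMeasureFamily ∘ ofGlobalUnits) (e(𝔠))` levelwise for EVERY `𝔠 ∈ I`, `σ_𝔠 ∈ Γ_K` ARBITRARY
  lifts of the Artin symbols (division data for `𝔞₁, 𝔞₂` in the relative currency of `hgen_artin`/`hpow_artin`/`hunb_artin`/`hτ_artin`);
  + `…_of_lifts`: the same with the division data for ANY other lifts `t₁, t₂` of the Artin symbols of `𝔞₁, 𝔞₂` (VERBATIM the
  dischargers' outputs; the data depend only on the cells — `ProfiniteGroupDistributionDivisionDataCongr.lean`)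
  + ★★★ `…_of_principal`: DIVISION DATA DISCHARGED for two principal twists `(α₁), (α₂)` in the family (the `Γ_K` twin of cf2c-w4
  g10's `…_of_principal`: `hgen_artin`/`hpow_artin`/`hunb_artin`/`hτ_artin` on the canonical lifts, transported to the family's lifts);
  + ★ `induceFrom_μ_proj_ellipticUnitsGlobal` — CONSISTENCY: on the cells inside `Gal(K̄/K(𝔪))` the induced measure of `e(𝔠)` IS
  p747710's one-`𝔓` measure of `ellipticUnitsLocal` (I.3.4 Lemma (ii));
* §4 ★ `integral_eq_sum_ellipticUnitsGlobal` — its integrals ((29)↔(31) with (16), II.4.7): for `𝒪_v ≅ ℤ₂` (`K(𝔪v) = K(𝔪)`,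
  `absRayAdicTower_U_zero_eq_ker`), `∫_{Γ_K} χ dμ = (χ(σ_𝔠) − N𝔠)⁻¹ Σ_{c ∈ Γ_K/Gal(K̄/K(𝔪))} χ(r_c) ∫_H χ d i_𝔓((r_c⁻¹ • e(𝔠))_𝔓)` for
  every tower-continuous multiplicative `χ` — the sum over `Gal(K(𝔪)/K)` of II.4.7 (16).

What is NOT here: the identification of the local integrals with Coleman derivatives / `L`-values (II.4.7–4.10:
`integral_character_pow_succ_ellipticUnitsLocal` of `…EllipticUnitsLocalMoments` at each conjugate, then B6), the glue across
moduli (II.4.12 (ii)), and `IsLMeasure`.  HONEST FRAMING: an assembly of accepted kernel theorems over published named facts;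
nothing here closes a crux; no summit statement is proved; BSD is not proved by any of this.

## References
* [deShalit1987] E. de Shalit, *Iwasawa theory of elliptic curves with complex multiplication* (1987), II.4.1 (p. 56), II.4.6 (14)
  (p. 59), II.4.7 (16) (p. 60), II.4.12 (29)–(33) (p. 66–69), II.2.4 (ii) (p. 44), I.3.4 (p. 18), II.4.17 (p. 77–78).
-/

-- the summit namespace `Summit.BirchSwinnertonDyer.BirchSwinnertonDyer` repeats the problem name by design (D-0017)
set_option linter.dupNamespace false
set_option autoImplicit false

noncomputable section

open scoped Classical nonZeroDivisors
open scoped NumberField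
open Field IsDedekindDomain IsDedekindDomain.HeightOneSpectrum ValuativeRel IsLocalRing MvPowerSeries
open Literature.NumberTheory.NumberFields
open Literature.NumberTheory.GaloisRepresentations Literature.NumberTheory.GaloisRepresentations.IsNonarchimedeanLocalField
  Literature.NumberTheory.GaloisRepresentations.LubinTate Literature.NumberTheory.GaloisRepresentations.ArtinLocalGlobal
  Literature.NumberTheory.PAdicHodge
open Literature.NumberTheory.EllipticCurves Literature.NumberTheory.EllipticCurves.GroupDistribution
open Literature.NumberTheory.ComplexMultiplication.EllipticUnits
open Literature.NumberTheory.LFunctions.AbelianDensity (artinSymbol)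
open Summit.BirchSwinnertonDyer.BirchSwinnertonDyer.Theorems.PrintCf2.EllipticUnitsLocal

namespace Summit.BirchSwinnertonDyer.BirchSwinnertonDyer.Theorems.PrintCf2.EllipticUnitsGlobal

variable {K : Type} [Field K] [NumberField K] {𝔪 : Ideal (𝓞 K)} {v : HeightOneSpectrum (𝓞 K)}

attribute [local instance] GlobalNormCoherentUnits.instCommMonoid GlobalNormCoherentUnits.galAction

/-! ## §3. de Shalit II.4.12 ON `Γ_K` for the elliptic units -/

section Assembly

attribute [local instance] ltNormUniformSpace ltNormIsUniformAddGroup rk1 nF nE fintypeResidueField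
attribute [local instance] RelNormCoherentUnits.instCommMonoid

variable [NumberField.IsTotallyComplex K]
  -- the prints and the global frame
  (h24ii : DeShalit1987.prop24_ii_galoisAction) (h24iii : DeShalit1987.prop24_iii_unit) (h25 : DeShalit1987.prop25_i_normRelation)
  (hK : IsImaginaryQuadratic K) (ι : K →+* ℂ)
  (h𝔪0 : 𝔪 ≠ ⊥) (h𝔪1 : 𝔪 ≠ ⊤) (hv : ¬ 𝔪 ≤ v.asIdeal) (hw : ∀ u : (𝓞 K)ˣ, (u : 𝓞 K) - 1 ∈ 𝔪 → u = 1)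
  -- the absolute Lubin–Tate model `π = u·2` at `v` and its unramified base `E`
  (hq : residueFieldCard (v.adicCompletion K) = 2)
  (h2 : (valuation (v.adicCompletion K)).IsUniformizer ((((2 : ℕ) : 𝒪[v.adicCompletion K]) : v.adicCompletion K)))
  (u : 𝒪[v.adicCompletion K]ˣ)
  {α : 𝓞 K} (hα0 : α ≠ 0) (hα𝔪 : α - 1 ∈ 𝔪) (hαw : ∀ w : HeightOneSpectrum (𝓞 K), w ≠ v → α ∉ w.asIdeal)
  {f : ℕ} (hαπ : ((α : K) : v.adicCompletion K) =
    ((((u : 𝒪[v.adicCompletion K]) * ((2 : ℕ) : 𝒪[v.adicCompletion K]) : 𝒪[v.adicCompletion K]) : v.adicCompletion K)) ^ f)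
  (E : IntermediateField (v.adicCompletion K) (AlgebraicClosure (v.adicCompletion K)))
  [FiniteDimensional (v.adicCompletion K) E] [IsGalois (v.adicCompletion K) E] (hE : E ≤ maxUnramified (v.adicCompletion K))
  (hdegE : ∀ w : WeilGroup (v.adicCompletion K),
    WeilGroup.toAbsGalois (v.adicCompletion K) w ∈ E.fixingSubgroup → (f : ℤ) ∣ WeilGroup.deg w)
  -- the local analytic data
  {σ₀ : absoluteGaloisGroup (v.adicCompletion K)} (hσ₀ : IsAbsArithFrob σ₀)
  {ε : (maxUnramifiedCompletion (v.adicCompletion K))ˣ}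
  (hε : maxUnramifiedCompletion.galAut (v.adicCompletion K) σ₀ (ε : maxUnramifiedCompletion (v.adicCompletion K)) =
    algebraMap 𝒪[v.adicCompletion K] (maxUnramifiedCompletion (v.adicCompletion K)) (u : 𝒪[v.adicCompletion K]) *
      (ε : maxUnramifiedCompletion (v.adicCompletion K)))
  (θ : CompletedAlgClosure (v.adicCompletion K) →+* ℂ_[2])
  (hθ1 : ∀ z : CBall (v.adicCompletion K), ‖θ (z : CompletedAlgClosure (v.adicCompletion K))‖ ≤ 1)
  (j : unitBall E →+* UnrCoeff (v.adicCompletion K))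
  (hj : j.comp (algebraMap (LTCoeff (v.adicCompletion K)) (unitBall E)) =
    (intToUnrCoeff (v.adicCompletion K)).comp (LTCoeff.of (v.adicCompletion K)).symm.toRingHom)
  (hjC : (algebraMap (UnrCoeff (v.adicCompletion K)) (CBall (v.adicCompletion K))).comp j = unitBallToCBall E)
  (e₂ : v.adicCompletionIntegers K ≃+* ℤ_[2])
  (hΘe : ∀ a : 𝒪[v.adicCompletion K], (θ.comp ((CBall (v.adicCompletion K)).subtype.comp
      (algebraMap (UnrCoeff (v.adicCompletion K)) (CBall (v.adicCompletion K))))) (intToUnrCoeff (v.adicCompletion K) a) =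
    padicIntCast ℂ_[2] (((e₂ : v.adicCompletionIntegers K →+* ℤ_[2]).comp
      (integerEquivAdicCompletionIntegers v).toRingHom) a))
  -- the cell maps of the relative tower `K(𝔪v^{n+1})` inside `Gal(K̄/K(𝔪))` for `κ := κ_v⁻¹` read in `ℤ₂`
  (ψ : (n : ℕ) → ↥(absRestrictNormalHom (rayClassField K 𝔪)).ker ⧸ (rayAdicTower (𝔪 := 𝔪) h𝔪0 v).U n → ZMod (2 ^ (n + 1)))
  (hψ : ∀ (n : ℕ) (g : ↥(absRestrictNormalHom (rayClassField K 𝔪)).ker), g ∈ (rayAdicTower (𝔪 := 𝔪) h𝔪0 v).U 0 →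
    ψ n ((rayAdicTower (𝔪 := 𝔪) h𝔪0 v).proj n g) =
      PadicInt.toZModPow (n + 1) ((((Units.map (e₂ : v.adicCompletionIntegers K →+* ℤ_[2]).toMonoidHom).comp
        (rayAdicCharacter h𝔪0 hv hw))⁻¹ g : ℤ_[2]ˣ) : ℤ_[2]))
  -- the twists: ideals `𝔠` prime to `𝔪v`, ARBITRARY Galois lifts `g_𝔠 ∈ Γ_K` of their Artin symbols, elliptic-unit families
  {I : Type*} (idl : I → Ideal (𝓞 K)) (hidl0 : ∀ i, idl i ≠ ⊥) (hidlc : ∀ i, IsCoprime (idl i) (𝔪 * v.asIdeal))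
  (g : I → absoluteGaloisGroup K)
  (hg : ∀ (i : I) (m : ℕ), absRestrictNormalHom (rayClassField K (𝔪 * v.asIdeal ^ (m + 1))) (g i) =
    artinSymbol (galFrob K (rayClassField K (𝔪 * v.asIdeal ^ (m + 1)))) (idl i))
  (x : ∀ (i : I) (m : ℕ), rayClassField K (𝔪 * v.asIdeal ^ (m + 1)))
  (hx : ∀ (i : I) (m : ℕ), IsThetaValueOne ι (𝔪 * v.asIdeal ^ (m + 1)) (idl i)
    (algClosureEmb ι ((x i m : rayClassField K (𝔪 * v.asIdeal ^ (m + 1))) : AlgebraicClosure K)))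
  [hN : ∀ n, ((rayAdicTower (𝔪 := 𝔪) h𝔪0 v).U n).Normal]
  [hNabs : ∀ n, ((absRayAdicTower (𝔪' := 𝔪) h𝔪0 v).U n).Normal]

set_option maxHeartbeats 800000 in
include h24ii hj hΘe hg in
/-- ★★★ **de Shalit II.4.12 ON `𝒢 = Γ_K` for the elliptic units — the measure `μ(𝔪)` on `Γ_K` EXISTS, with the twisting relation for
EVERY `𝔠`.**  In the setting of `…EllipticUnitsLocal.exists_groupDistribution_twisting_eq_induce_ellipticUnitsLocal` (p747710: `K` imaginary
quadratic, `𝔪 ≠ 0, 𝒪_K`, `v ∤ 𝔪`, `w_𝔪 = 1`; the absolute Lubin–Tate model at `v` with its local analytic data; cell maps `ψ`; GIVEN de Shalit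
II.2.4 (ii)/(iii), II.2.5 (i)), but with ARBITRARY Galois lifts `g_𝔠 ∈ Γ_K` of the Artin symbols (`exists_forall_absRestrictNormalHom_eq_artinSymbol`;
no "`g_𝔠` fixes `K(𝔪)`") and two auxiliary indices `𝔞₁, 𝔞₂` whose lifts DO fix `K(𝔪)` and carry the division data in the relative tower
(`hgen_artin`/`hpow_artin`/`hunb_artin`/`hτ_artin` currency): **there is a bounded distribution `μ` on `Γ_K` along `Gal(K̄/K(𝔪v^{n+1}))`
(`absRayAdicTower h𝔪 v`), `‖μ‖ = 1`, with `δ_{g_𝔠, N𝔠} μ = i(e(𝔠))` levelwise for EVERY `𝔠 ∈ I`**, where `i = induceFrom` (de Shalit's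
`𝒢`-homomorphism `i : 𝒰 → Λ(𝒢)`, I.3.4/II.4.6) of the one-`𝔓` family `localMeasureFamily ∘ ofGlobalUnits` applied to the GLOBAL elliptic
units `e(𝔠)`. [cite: deShalit1987, II.4.12 (p. 66–69), II.4.6 (14) (p. 59), I.3.4 (p. 18), II.2.4 (ii) (p. 44), II.4.1 (p. 56)] -/
theorem exists_groupDistribution_twisting_eq_induceFrom_ellipticUnitsGlobal
    {s : ℕ} (a₁ a₂ : I)
    (hg₁H : g a₁ ∈ (absRestrictNormalHom (rayClassField K 𝔪)).ker) (hg₂H : g a₂ ∈ (absRestrictNormalHom (rayClassField K 𝔪)).ker)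
    (hσ₁ : (⟨g a₁, hg₁H⟩ : ↥(absRestrictNormalHom (rayClassField K 𝔪)).ker) ∈ (rayAdicTower (𝔪 := 𝔪) h𝔪0 v).U s)
    (hσ₂ : (⟨g a₂, hg₂H⟩ : ↥(absRestrictNormalHom (rayClassField K 𝔪)).ker) ∈ (rayAdicTower (𝔪 := 𝔪) h𝔪0 v).U s)
    (hgen : ∀ m, s ≤ m → ∀ w ∈ (rayAdicTower (𝔪 := 𝔪) h𝔪0 v).U s, ∃ k : ℕ,
      (rayAdicTower (𝔪 := 𝔪) h𝔪0 v).proj m ((⟨g a₁, hg₁H⟩ : ↥(absRestrictNormalHom (rayClassField K 𝔪)).ker) ^ k) =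
        (rayAdicTower (𝔪 := 𝔪) h𝔪0 v).proj m w)
    (hpow : ∀ n, s ≤ n → ∃ r : ℕ,
      orderOf ((rayAdicTower (𝔪 := 𝔪) h𝔪0 v).proj n (⟨g a₁, hg₁H⟩ : ↥(absRestrictNormalHom (rayClassField K 𝔪)).ker)) = 2 ^ r)
    (hunb : ∀ r : ℕ, ∃ m,
      2 ^ r ∣ orderOf ((rayAdicTower (𝔪 := 𝔪) h𝔪0 v).proj m (⟨g a₁, hg₁H⟩ : ↥(absRestrictNormalHom (rayClassField K 𝔪)).ker)))
    (hN1 : 2 ≤ Ideal.absNorm (idl a₁)) (h4 : 4 ∣ Ideal.absNorm (idl a₁) - 1) (hN12 : Ideal.absNorm (idl a₂) = Ideal.absNorm (idl a₁))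
    (hτ : ∀ k, 0 < k → ∃ n, s ≤ n ∧
      (⟨g a₂, hg₂H⟩ : ↥(absRestrictNormalHom (rayClassField K 𝔪)).ker) ^ k *
        ((⟨g a₁, hg₁H⟩ : ↥(absRestrictNormalHom (rayClassField K 𝔪)).ker) ^ k)⁻¹ ∉ (rayAdicTower (𝔪 := 𝔪) h𝔪0 v).U n) :
    ∃ μ : GroupDistribution (absRayAdicTower (𝔪' := 𝔪) h𝔪0 v) ℂ_[2], μ.bound = 1 ∧
      ∀ (c : I) (n : ℕ) (b : absoluteGaloisGroup K ⧸ (absRayAdicTower (𝔪' := 𝔪) h𝔪0 v).U n),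
        (twisting (g c) (Ideal.absNorm (idl c) : ℂ_[2]) μ).μ n b =
        (GroupDistribution.induceFrom (Γ := absoluteGaloisGroup K) (fun n ↦ rayAdicTower_U_eq_subgroupOf (𝔪 := 𝔪) h𝔪0 v n)
          (fun b : GlobalNormCoherentUnits h𝔪0 v ↦
            localMeasureFamily h𝔪0 hv hw hq h2 u E hE hσ₀ hε θ hθ1 j hjC e₂ ψ hψ
              (RelNormCoherentUnits.ofGlobalUnits h𝔪0 hv hw (isUniformizer_unit_mul h2 u) hα0 hα𝔪 hαw hαπ E hE hdegE b))
          zero_le_one (fun _ ↦ le_rfl)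
          (ellipticUnitsGlobal h24iii h25 hK ι h𝔪0 h𝔪1 hv hw (hidl0 c) (hidlc c) (x c) (hx c))).μ n b := by
  letI := rayAction h𝔪0 hv hw (isUniformizer_unit_mul h2 u) E hE
  refine exists_twisting_μ_eq_forall_induceFrom_of_subgroup_data (Γ := absoluteGaloisGroup K)
    (H := (absRestrictNormalHom (rayClassField K 𝔪)).ker) (𝒰 := absRayAdicTower (𝔪' := 𝔪) h𝔪0 v)
    (𝒱 := rayAdicTower (𝔪 := 𝔪) h𝔪0 v) (fun n ↦ rayAdicTower_U_eq_subgroupOf (𝔪 := 𝔪) h𝔪0 v n) _ zero_le_one (fun _ ↦ le_rfl)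
    (fun c ↦ ellipticUnitsGlobal h24iii h25 hK ι h𝔪0 h𝔪1 hv hw (hidl0 c) (hidlc c) (x c) (hx c)) g
    (fun c ↦ Ideal.absNorm (idl c)) (absRayAdicTower_U_le_ker h𝔪0 v le_rfl 0) ?_ ?_ ?_
    (commutator_mem_absRayAdicTower_U h𝔪0 v) a₁ a₂ hg₁H hg₂H hσ₁ hσ₂ hgen hpow hunb hN1 (dvd_trans ⟨2, rfl⟩ h4) (fun _ ↦ h4) hN12 hτ
  · -- `H`-equivariance: the `κ_v`-action on `𝒰_𝔓` is the restriction of the `Γ_K`-action on the global units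
    exact fun h b n a ↦ globalMeasureFamily_μ_smul h𝔪0 hv hw hq h2 u hα0 hα𝔪 hαw hαπ E hE hdegE hσ₀ hε θ hθ1 j hj hjC e₂ hΘe
      ψ hψ h b n a
  · -- additivity
    exact fun b b' n a ↦ globalMeasureFamily_μ_mul h𝔪0 hv hw hq h2 u hα0 hα𝔪 hαw hαπ E hE hdegE hσ₀ hε θ hθ1 j hjC e₂ ψ hψ
      b b' n a
  · -- II.2.4 (ii) in the `Γ_K`-monoid
    exact fun a c ↦ hrel_ellipticUnitsGlobal h24ii h24iii h25 hK ι h𝔪0 h𝔪1 hv hw (hidl0 a) (hidlc a) (hidl0 c) (hidlc c)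
      (x a) (hx a) (x c) (hx c) (g a) (g c) (hg a) (hg c)

set_option maxHeartbeats 800000 in
include h24ii hj hΘe hg in
/-- ★★★ **The same with the division data carried by ANY OTHER lifts `t₁, t₂ ∈ Gal(K̄/K(𝔪))` of the Artin symbols of `𝔞₁, 𝔞₂`** —
VERBATIM the outputs of the dischargers `hgen_artin` / `hpow_artin` / `hunb_artin` / `hτ_artin` for their own lifts `⟨σ, hσ𝔪⟩`: the
division data depend only on the cells `σ U_n`, i.e. on the restrictions to the `K(𝔪v^{n+1})`
(`ProfiniteGroupDistributionDivisionDataCongr.lean`), and any two lifts of the same Artin symbols have the same cells.  So the twist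
family's lifts `g_𝔠` may be chosen freely (e.g. by `exists_forall_absRestrictNormalHom_eq_artinSymbol`), independently of the
dischargers. [cite: deShalit1987, II.4.12 (p. 66–69), I.3.4 (p. 18)] [cite: NeukirchANT1999, Ch. VI §7 Thm. (7.1)] -/
theorem exists_groupDistribution_twisting_eq_induceFrom_ellipticUnitsGlobal_of_lifts
    {s : ℕ} (a₁ a₂ : I) (t₁ t₂ : ↥(absRestrictNormalHom (rayClassField K 𝔪)).ker)
    (ht₁ : ∀ m : ℕ, absRestrictNormalHom (rayClassField K (𝔪 * v.asIdeal ^ (m + 1))) (t₁ : absoluteGaloisGroup K) =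
      artinSymbol (galFrob K (rayClassField K (𝔪 * v.asIdeal ^ (m + 1)))) (idl a₁))
    (ht₂ : ∀ m : ℕ, absRestrictNormalHom (rayClassField K (𝔪 * v.asIdeal ^ (m + 1))) (t₂ : absoluteGaloisGroup K) =
      artinSymbol (galFrob K (rayClassField K (𝔪 * v.asIdeal ^ (m + 1)))) (idl a₂))
    (hσ₁ : t₁ ∈ (rayAdicTower (𝔪 := 𝔪) h𝔪0 v).U s) (hσ₂ : t₂ ∈ (rayAdicTower (𝔪 := 𝔪) h𝔪0 v).U s)
    (hgen : ∀ m, s ≤ m → ∀ w ∈ (rayAdicTower (𝔪 := 𝔪) h𝔪0 v).U s, ∃ k : ℕ,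
      (rayAdicTower (𝔪 := 𝔪) h𝔪0 v).proj m (t₁ ^ k) = (rayAdicTower (𝔪 := 𝔪) h𝔪0 v).proj m w)
    (hpow : ∀ n, s ≤ n → ∃ r : ℕ, orderOf ((rayAdicTower (𝔪 := 𝔪) h𝔪0 v).proj n t₁) = 2 ^ r)
    (hunb : ∀ r : ℕ, ∃ m, 2 ^ r ∣ orderOf ((rayAdicTower (𝔪 := 𝔪) h𝔪0 v).proj m t₁))
    (hN1 : 2 ≤ Ideal.absNorm (idl a₁)) (h4 : 4 ∣ Ideal.absNorm (idl a₁) - 1) (hN12 : Ideal.absNorm (idl a₂) = Ideal.absNorm (idl a₁))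
    (hτ : ∀ k, 0 < k → ∃ n, s ≤ n ∧ t₂ ^ k * (t₁ ^ k)⁻¹ ∉ (rayAdicTower (𝔪 := 𝔪) h𝔪0 v).U n) :
    ∃ μ : GroupDistribution (absRayAdicTower (𝔪' := 𝔪) h𝔪0 v) ℂ_[2], μ.bound = 1 ∧
      ∀ (c : I) (n : ℕ) (b : absoluteGaloisGroup K ⧸ (absRayAdicTower (𝔪' := 𝔪) h𝔪0 v).U n),
        (twisting (g c) (Ideal.absNorm (idl c) : ℂ_[2]) μ).μ n b =
        (GroupDistribution.induceFrom (Γ := absoluteGaloisGroup K) (fun n ↦ rayAdicTower_U_eq_subgroupOf (𝔪 := 𝔪) h𝔪0 v n)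
          (fun b : GlobalNormCoherentUnits h𝔪0 v ↦
            localMeasureFamily h𝔪0 hv hw hq h2 u E hE hσ₀ hε θ hθ1 j hjC e₂ ψ hψ
              (RelNormCoherentUnits.ofGlobalUnits h𝔪0 hv hw (isUniformizer_unit_mul h2 u) hα0 hα𝔪 hαw hαπ E hE hdegE b))
          zero_le_one (fun _ ↦ le_rfl)
          (ellipticUnitsGlobal h24iii h25 hK ι h𝔪0 h𝔪1 hv hw (hidl0 c) (hidlc c) (x c) (hx c))).μ n b := by
  -- any two lifts of the same Artin symbols have the same cells in `Γ_K ⧸ Gal(K̄/K(𝔪v^{n+1}))`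
  have habs : ∀ (i : I) (t : ↥(absRestrictNormalHom (rayClassField K 𝔪)).ker),
      (∀ m : ℕ, absRestrictNormalHom (rayClassField K (𝔪 * v.asIdeal ^ (m + 1))) (t : absoluteGaloisGroup K) =
        artinSymbol (galFrob K (rayClassField K (𝔪 * v.asIdeal ^ (m + 1)))) (idl i)) →
      ∀ n, (absRayAdicTower (𝔪' := 𝔪) h𝔪0 v).proj n (g i) =
        (absRayAdicTower (𝔪' := 𝔪) h𝔪0 v).proj n (t : absoluteGaloisGroup K) :=
    fun i t ht n ↦ (absRayAdicTower (𝔪' := 𝔪) h𝔪0 v).proj_eq_of_map_eq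
      (absRestrictNormalHom (rayClassField K (𝔪 * v.asIdeal ^ (n + 1)))) rfl ((hg i n).trans (ht n).symm)
  -- hence `g 𝔞ᵢ ∈ Gal(K̄/K(𝔪))`
  have hmem : ∀ (i : I) (t : ↥(absRestrictNormalHom (rayClassField K 𝔪)).ker),
      (∀ m : ℕ, absRestrictNormalHom (rayClassField K (𝔪 * v.asIdeal ^ (m + 1))) (t : absoluteGaloisGroup K) =
        artinSymbol (galFrob K (rayClassField K (𝔪 * v.asIdeal ^ (m + 1)))) (idl i)) →
      g i ∈ (absRestrictNormalHom (rayClassField K 𝔪)).ker := by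
    intro i t ht
    have h0 : (g i)⁻¹ * (t : absoluteGaloisGroup K) ∈ (absRestrictNormalHom (rayClassField K 𝔪)).ker :=
      absRayAdicTower_U_le_ker h𝔪0 v le_rfl 0 (((absRayAdicTower (𝔪' := 𝔪) h𝔪0 v).proj_eq_iff).mp (habs i t ht 0))
    have h1 : g i = (t : absoluteGaloisGroup K) * ((g i)⁻¹ * (t : absoluteGaloisGroup K))⁻¹ := by group
    rw [h1]
    exact Subgroup.mul_mem _ t.2 (Subgroup.inv_mem _ h0)
  have hg₁H := hmem a₁ t₁ ht₁
  have hg₂H := hmem a₂ t₂ ht₂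
  -- and the same cells in the relative tower
  have hrel₁ : ∀ n, (rayAdicTower (𝔪 := 𝔪) h𝔪0 v).proj n (⟨g a₁, hg₁H⟩ : ↥(absRestrictNormalHom (rayClassField K 𝔪)).ker) =
      (rayAdicTower (𝔪 := 𝔪) h𝔪0 v).proj n t₁ :=
    fun n ↦ (proj_coe_eq_iff (𝒰 := absRayAdicTower (𝔪' := 𝔪) h𝔪0 v) (𝒱 := rayAdicTower (𝔪 := 𝔪) h𝔪0 v)
      (fun n ↦ rayAdicTower_U_eq_subgroupOf (𝔪 := 𝔪) h𝔪0 v n)).mp (habs a₁ t₁ ht₁ n)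
  have hrel₂ : ∀ n, (rayAdicTower (𝔪 := 𝔪) h𝔪0 v).proj n (⟨g a₂, hg₂H⟩ : ↥(absRestrictNormalHom (rayClassField K 𝔪)).ker) =
      (rayAdicTower (𝔪 := 𝔪) h𝔪0 v).proj n t₂ :=
    fun n ↦ (proj_coe_eq_iff (𝒰 := absRayAdicTower (𝔪' := 𝔪) h𝔪0 v) (𝒱 := rayAdicTower (𝔪 := 𝔪) h𝔪0 v)
      (fun n ↦ rayAdicTower_U_eq_subgroupOf (𝔪 := 𝔪) h𝔪0 v n)).mp (habs a₂ t₂ ht₂ n)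
  exact exists_groupDistribution_twisting_eq_induceFrom_ellipticUnitsGlobal h24ii h24iii h25 hK ι h𝔪0 h𝔪1 hv hw hq h2 u hα0 hα𝔪 hαw
    hαπ E hE hdegE hσ₀ hε θ hθ1 j hj hjC e₂ hΘe ψ hψ idl hidl0 hidlc g hg x hx a₁ a₂ hg₁H hg₂H
    (((rayAdicTower (𝔪 := 𝔪) h𝔪0 v).mem_U_iff_of_forall_proj_eq hrel₁ s).mpr hσ₁)
    (((rayAdicTower (𝔪 := 𝔪) h𝔪0 v).mem_U_iff_of_forall_proj_eq hrel₂ s).mpr hσ₂)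
    ((rayAdicTower (𝔪 := 𝔪) h𝔪0 v).hgen_of_forall_proj_eq hrel₁ hgen)
    ((rayAdicTower (𝔪 := 𝔪) h𝔪0 v).hpow_of_forall_proj_eq hrel₁ hpow)
    ((rayAdicTower (𝔪 := 𝔪) h𝔪0 v).hunb_of_forall_proj_eq hrel₁ hunb) hN1 h4 hN12
    ((rayAdicTower (𝔪 := 𝔪) h𝔪0 v).hτ_of_forall_proj_eq hrel₁ hrel₂ hτ)

set_option maxHeartbeats 800000 in
include h24ii hj hΘe hg in
/-- ★★★ **de Shalit II.4.12 ON `Γ_K`, DIVISION DATA DISCHARGED** (the `Γ_K` twin of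
`EllipticUnitsLocal.exists_groupDistribution_twisting_eq_induce_ellipticUnitsLocal_of_principal`): if the twist family contains two
PRINCIPAL twists `𝔞₁ = (α₁)`, `𝔞₂ = (α₂)` with `αᵢ ≡ 1 mod 𝔪`, `α₁ − 1 ∈ v^{s+1} ∖ v^{s+2}`, `1 ≤ s`, `α₂ − 1 ∈ v^{s+1}`, `α₂ᵏ ≠ α₁ᵏ` in
`K_v` (`k > 0`), `N𝔞₁ = N𝔞₂ ≥ 2`, `4 ∣ N𝔞₁ − 1` — with the lifts `g_𝔠 ∈ Γ_K` of the WHOLE family (including `g_{𝔞ᵢ}`) ARBITRARY — then the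
measure `μ(𝔪)` on `Γ_K` with `δ_{g_𝔠, N𝔠} μ = i(e(𝔠))` for every `𝔠` EXISTS: the division data are produced for the canonical lifts of
`((αᵢ), ·)` by cf2c-w4 g8's `artin_mem_rayAdicTower_U_iff` / `hgen_artin` / `hpow_artin` / `hunb_artin` / `hτ_artin` and transported to
`g_{𝔞ᵢ}` by `…_of_lifts`. [cite: deShalit1987, II.4.12 (p. 66–69), II.4.17 (p. 77–78)] [cite: NeukirchANT1999, Ch. VI §7 Thm. (7.1)] -/
theorem exists_groupDistribution_twisting_eq_induceFrom_ellipticUnitsGlobal_of_principal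
    {s : ℕ} (hs : 1 ≤ s) (a₁ a₂ : I) {α₁ α₂ : 𝓞 K} (ha₁ : idl a₁ = Ideal.span {α₁}) (ha₂ : idl a₂ = Ideal.span {α₂})
    (hα₁𝔪 : α₁ - 1 ∈ 𝔪) (hα₂𝔪 : α₂ - 1 ∈ 𝔪)
    (hs₁ : α₁ - 1 ∈ v.asIdeal ^ (s + 1)) (hs₁' : α₁ - 1 ∉ v.asIdeal ^ (s + 2)) (hs₂ : α₂ - 1 ∈ v.asIdeal ^ (s + 1))
    (hne : ∀ k : ℕ, 0 < k → ((α₂ : K) : v.adicCompletion K) ^ k ≠ ((α₁ : K) : v.adicCompletion K) ^ k)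
    (hN1 : 2 ≤ Ideal.absNorm (idl a₁)) (h4 : 4 ∣ Ideal.absNorm (idl a₁) - 1) (hN12 : Ideal.absNorm (idl a₂) = Ideal.absNorm (idl a₁)) :
    ∃ μ : GroupDistribution (absRayAdicTower (𝔪' := 𝔪) h𝔪0 v) ℂ_[2], μ.bound = 1 ∧
      ∀ (c : I) (n : ℕ) (b : absoluteGaloisGroup K ⧸ (absRayAdicTower (𝔪' := 𝔪) h𝔪0 v).U n),
        (twisting (g c) (Ideal.absNorm (idl c) : ℂ_[2]) μ).μ n b =
        (GroupDistribution.induceFrom (Γ := absoluteGaloisGroup K) (fun n ↦ rayAdicTower_U_eq_subgroupOf (𝔪 := 𝔪) h𝔪0 v n)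
          (fun b : GlobalNormCoherentUnits h𝔪0 v ↦
            localMeasureFamily h𝔪0 hv hw hq h2 u E hE hσ₀ hε θ hθ1 j hjC e₂ ψ hψ
              (RelNormCoherentUnits.ofGlobalUnits h𝔪0 hv hw (isUniformizer_unit_mul h2 u) hα0 hα𝔪 hαw hαπ E hE hdegE b))
          zero_le_one (fun _ ↦ le_rfl)
          (ellipticUnitsGlobal h24iii h25 hK ι h𝔪0 h𝔪1 hv hw (hidl0 c) (hidlc c) (x c) (hx c))).μ n b := by
  -- the canonical lifts of the two principal Artin symbols (they FIX `K(𝔪)`), in g8's `hσ`-currency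
  have hα0₁ : α₁ ≠ 0 := ne_zero_of_span_singleton_eq (hidl0 a₁) ha₁
  have hα0₂ : α₂ ≠ 0 := ne_zero_of_span_singleton_eq (hidl0 a₂) ha₂
  have hαv₁ : α₁ ∉ v.asIdeal := not_mem_of_isCoprime_mul (hidlc a₁) ha₁
  have hαv₂ : α₂ ∉ v.asIdeal := not_mem_of_isCoprime_mul (hidlc a₂) ha₂
  obtain ⟨t₁, hσ⟩ := exists_forall_absRestrictNormalHom_eq_artinHom_span_singleton h𝔪0 hv hα0₁ hα₁𝔪 hαv₁
  obtain ⟨t₂, hτ'⟩ := exists_forall_absRestrictNormalHom_eq_artinHom_span_singleton h𝔪0 hv hα0₂ hα₂𝔪 hαv₂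
  have ht₁𝔪 := mem_ker_of_forall_absRestrictNormalHom_eq_artinHom h𝔪0 hv hα0₁ hα₁𝔪 hαv₁ hσ
  have ht₂𝔪 := mem_ker_of_forall_absRestrictNormalHom_eq_artinHom h𝔪0 hv hα0₂ hα₂𝔪 hαv₂ hτ'
  have ht₁ : ∀ m : ℕ, absRestrictNormalHom (rayClassField K (𝔪 * v.asIdeal ^ (m + 1))) t₁ =
      artinSymbol (galFrob K (rayClassField K (𝔪 * v.asIdeal ^ (m + 1)))) (idl a₁) := fun m ↦ by
    rw [ha₁, hσ (m + 1), artinHom_toPrincipalIdeal_coe _ hα0₁]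
  have ht₂ : ∀ m : ℕ, absRestrictNormalHom (rayClassField K (𝔪 * v.asIdeal ^ (m + 1))) t₂ =
      artinSymbol (galFrob K (rayClassField K (𝔪 * v.asIdeal ^ (m + 1)))) (idl a₂) := fun m ↦ by
    rw [ha₂, hτ' (m + 1), artinHom_toPrincipalIdeal_coe _ hα0₂]
  have hp2 : (2 : ℕ) = 2 → 1 ≤ s := fun _ ↦ hs
  exact exists_groupDistribution_twisting_eq_induceFrom_ellipticUnitsGlobal_of_lifts h24ii h24iii h25 hK ι h𝔪0 h𝔪1 hv hw hq h2 u
    hα0 hα𝔪 hαw hαπ E hE hdegE hσ₀ hε θ hθ1 j hj hjC e₂ hΘe ψ hψ idl hidl0 hidlc g hg x hx a₁ a₂ ⟨t₁, ht₁𝔪⟩ ⟨t₂, ht₂𝔪⟩ ht₁ ht₂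
    ((artin_mem_rayAdicTower_U_iff h𝔪0 hv hw hα0₁ hα₁𝔪 hαv₁ hσ ht₁𝔪 s).mpr hs₁)
    ((artin_mem_rayAdicTower_U_iff h𝔪0 hv hw hα0₂ hα₂𝔪 hαv₂ hτ' ht₂𝔪 s).mpr hs₂)
    (hgen_artin h𝔪0 h𝔪0 hv hw e₂ le_rfl hv hα0₁ hα₁𝔪 hαv₁ hσ ht₁𝔪 hs₁ hs₁' hp2)
    (hpow_artin h𝔪0 h𝔪0 hv hw e₂ le_rfl hv hα0₁ hα₁𝔪 hαv₁ hσ ht₁𝔪 hs₁ hs₁' hp2)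
    (hunb_artin h𝔪0 h𝔪0 hv hw e₂ le_rfl hv hα0₁ hα₁𝔪 hαv₁ hσ ht₁𝔪 hs₁ hs₁' hp2) hN1 h4 hN12
    (hτ_artin h𝔪0 h𝔪0 hv hw e₂ le_rfl hv hα0₁ hα₁𝔪 hαv₁ hα0₂ hα₂𝔪 hαv₂ hσ hτ' ht₁𝔪 ht₂𝔪 hne s)

set_option maxHeartbeats 800000 in
include hj hΘe in
/-- ★ **CONSISTENCY WITH THE ONE-`𝔓` MEASURE (I.3.4 Lemma (ii))**: on the cells inside `Gal(K̄/K(𝔪))` the induced measure of the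
global elliptic units IS p747710's one-`𝔓` measure of `ellipticUnitsLocal` — `i(e(𝔠))_n(x U_n) = i_𝔓(e(𝔠)_𝔓)_n(x V_n)` for
`x ∈ Gal(K̄/K(𝔪))` (`GroupDistribution.induceFrom_μ_proj`, `ofGlobalUnits_ellipticUnitsGlobal`).
[cite: deShalit1987, I.3.4 Lemma (ii) (p. 18), II.4.6 (p. 59)] -/
theorem induceFrom_μ_proj_ellipticUnitsGlobal (c : I) (n : ℕ) (y : ↥(absRestrictNormalHom (rayClassField K 𝔪)).ker) :
    (GroupDistribution.induceFrom (Γ := absoluteGaloisGroup K) (fun n ↦ rayAdicTower_U_eq_subgroupOf (𝔪 := 𝔪) h𝔪0 v n)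
        (fun b : GlobalNormCoherentUnits h𝔪0 v ↦
          localMeasureFamily h𝔪0 hv hw hq h2 u E hE hσ₀ hε θ hθ1 j hjC e₂ ψ hψ
            (RelNormCoherentUnits.ofGlobalUnits h𝔪0 hv hw (isUniformizer_unit_mul h2 u) hα0 hα𝔪 hαw hαπ E hE hdegE b))
        zero_le_one (fun _ ↦ le_rfl)
        (ellipticUnitsGlobal h24iii h25 hK ι h𝔪0 h𝔪1 hv hw (hidl0 c) (hidlc c) (x c) (hx c))).μ n
        ((absRayAdicTower (𝔪' := 𝔪) h𝔪0 v).proj n (y : absoluteGaloisGroup K)) =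
      (localMeasureFamily h𝔪0 hv hw hq h2 u E hE hσ₀ hε θ hθ1 j hjC e₂ ψ hψ
        (ellipticUnitsLocal h24iii h25 hK ι h𝔪0 h𝔪1 hv hw (isUniformizer_unit_mul h2 u) hα0 hα𝔪 hαw hαπ E hE hdegE
          (hidl0 c) (hidlc c) (x c) (hx c))).μ n ((rayAdicTower (𝔪 := 𝔪) h𝔪0 v).proj n y) :=
  induceFrom_μ_proj (Γ := absoluteGaloisGroup K) (H := (absRestrictNormalHom (rayClassField K 𝔪)).ker)
    (𝒰 := absRayAdicTower (𝔪' := 𝔪) h𝔪0 v) (𝒱 := rayAdicTower (𝔪 := 𝔪) h𝔪0 v)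
    (fun n ↦ rayAdicTower_U_eq_subgroupOf (𝔪 := 𝔪) h𝔪0 v n) _ zero_le_one (fun _ ↦ le_rfl)
    (absRayAdicTower_U_le_ker h𝔪0 v le_rfl 0)
    (fun h b n a ↦ globalMeasureFamily_μ_smul h𝔪0 hv hw hq h2 u hα0 hα𝔪 hαw hαπ E hE hdegE hσ₀ hε θ hθ1 j hj hjC e₂ hΘe
      ψ hψ h b n a) _ n y

/-! ## §4. The integrals of `μ(𝔪)` on `Γ_K`: the sum over `Gal(K(𝔪)/K)` of II.4.7 (16) with (29)↔(31) -/

set_option maxHeartbeats 800000 in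
/-- ★ **The integrals of de Shalit's measure on `𝒢`** (`𝒪_v ≅ ℤ₂`, so `K(𝔪v) = K(𝔪)` and `H = U_0`): if `δ_{g_𝔠, N𝔠} μ = i(e(𝔠))` levelwise
for every `𝔠` (the conclusion of `exists_groupDistribution_twisting_eq_induceFrom_ellipticUnitsGlobal`), then for every `𝔠` and every
tower-continuous multiplicative `χ : Γ_K → ℂ₂` with `χ(1) = 1`, `χ(g_𝔠) ≠ N𝔠`:
`∫_{Γ_K} χ dμ = (χ(g_𝔠) − N𝔠)⁻¹ · Σ_{c ∈ Γ_K/Gal(K̄/K(𝔪))} χ(r_c) · ∫_{Gal(K̄/K(𝔪))} χ d i_𝔓((r_c⁻¹ • e(𝔠))_𝔓)` — the local integrals being those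
of `…EllipticUnitsLocalMoments` at the Galois CONJUGATES `r_c⁻¹ • e(𝔠)` of the elliptic units (de Shalit's `Σ_𝔠 χφ^k(𝔠⁻¹) ∫_G … dμ_{σ_𝔠(β)}`).
[cite: deShalit1987, II.4.7 (16) (p. 60), II.4.12 (29)↔(31) (p. 67–69), II.4.17 (p. 77–78)] -/
theorem integral_eq_sum_ellipticUnitsGlobal
    (μ : GroupDistribution (absRayAdicTower (𝔪' := 𝔪) h𝔪0 v) ℂ_[2])
    (hμ : ∀ (c : I) (n : ℕ) (b : absoluteGaloisGroup K ⧸ (absRayAdicTower (𝔪' := 𝔪) h𝔪0 v).U n),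
        (twisting (g c) (Ideal.absNorm (idl c) : ℂ_[2]) μ).μ n b =
        (GroupDistribution.induceFrom (Γ := absoluteGaloisGroup K) (fun n ↦ rayAdicTower_U_eq_subgroupOf (𝔪 := 𝔪) h𝔪0 v n)
          (fun b : GlobalNormCoherentUnits h𝔪0 v ↦
            localMeasureFamily h𝔪0 hv hw hq h2 u E hE hσ₀ hε θ hθ1 j hjC e₂ ψ hψ
              (RelNormCoherentUnits.ofGlobalUnits h𝔪0 hv hw (isUniformizer_unit_mul h2 u) hα0 hα𝔪 hαw hαπ E hE hdegE b))
          zero_le_one (fun _ ↦ le_rfl)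
          (ellipticUnitsGlobal h24iii h25 hK ι h𝔪0 h𝔪1 hv hw (hidl0 c) (hidlc c) (x c) (hx c))).μ n b)
    (c : I) {χ : absoluteGaloisGroup K → ℂ_[2]} (hχc : (absRayAdicTower (𝔪' := 𝔪) h𝔪0 v).IsTowerContinuous χ)
    (hχ : ∀ y z, χ (y * z) = χ y * χ z) (h1 : χ 1 = 1) (hne : χ (g c) ≠ (Ideal.absNorm (idl c) : ℂ_[2])) :
    μ.integral χ = (χ (g c) - (Ideal.absNorm (idl c) : ℂ_[2]))⁻¹ *
      ∑ c' ∈ (absRayAdicTower (𝔪' := 𝔪) h𝔪0 v).cells 0, χ ((absRayAdicTower (𝔪' := 𝔪) h𝔪0 v).repr 0 c') *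
        (localMeasureFamily h𝔪0 hv hw hq h2 u E hE hσ₀ hε θ hθ1 j hjC e₂ ψ hψ
          (RelNormCoherentUnits.ofGlobalUnits h𝔪0 hv hw (isUniformizer_unit_mul h2 u) hα0 hα𝔪 hαw hαπ E hE hdegE
            (((absRayAdicTower (𝔪' := 𝔪) h𝔪0 v).repr 0 c')⁻¹ •
              ellipticUnitsGlobal h24iii h25 hK ι h𝔪0 h𝔪1 hv hw (hidl0 c) (hidlc c) (x c) (hx c)))).integral
          (fun y : ↥(absRestrictNormalHom (rayClassField K 𝔪)).ker ↦ χ y) :=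
  integral_eq_sum_of_twisting_eq_induceFrom_of_le (Γ := absoluteGaloisGroup K)
    (H := (absRestrictNormalHom (rayClassField K 𝔪)).ker) (𝒰 := absRayAdicTower (𝔪' := 𝔪) h𝔪0 v)
    (𝒱 := rayAdicTower (𝔪 := 𝔪) h𝔪0 v) (fun n ↦ rayAdicTower_U_eq_subgroupOf (𝔪 := 𝔪) h𝔪0 v n) _ zero_le_one (fun _ ↦ le_rfl)
    (fun c ↦ ellipticUnitsGlobal h24iii h25 hK ι h𝔪0 h𝔪1 hv hw (hidl0 c) (hidlc c) (x c) (hx c)) g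
    (fun c ↦ Ideal.absNorm (idl c)) (ker_le_absRayAdicTower_U_zero_of_padicIntEquiv_two h𝔪0 hv hw e₂) μ hμ c hχc hχ h1 hne

end Assembly

end Summit.BirchSwinnertonDyer.BirchSwinnertonDyer.Theorems.PrintCf2.EllipticUnitsGlobal

end
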